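import Summits.CriticalPhenomena.Ising3D.Control2DL15OpeEUB
import Summits.CriticalPhenomena.Ising3D.Control2DL15OpeELB
import Summits.CriticalPhenomena.Ising3D.Control2DOpeEpsRungs
import HarnessLib

/-!
# The 2D control's `λ²_σσε` datum TWO-SIDED on the kernel path at Λ = 15 (with the decimal sanity form)
(cell `pub-ising3x`, seat controls-1 gen 21; KERNEL PATH for the 2D γ-certificates, kind `ope2eps`, both senses — CONTROL-ONLY)

HONEST FRAMING: lottery ticket; floor = tightest certified 3D Ising CFT bounds; no exact-solution
claim without a proof. CONTROL-ONLY: `d = 2`, global blocks, `Δ_σ = 1/8` exact, the 2D axiom set `A2D′` with the CERTIFIED `ε` box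
`[197/200, 20001/20000]` as scalar input; nothing about `d = 3`.

`Control2DOpeEpsRungs.pBoxTwoSided_rb6_L15` (controls-1 g13) took the two RB-6 `ope2eps` certificates of kit job j140872 (Λ = 15, E₀ = 40;
lower P̃ = 15621/250000, upper P̃ = 319051/5000000; readers A 2.5 ∧ B 2.4 PASS) as HYPOTHESES. Both are now THEOREMS with every
obligation re-decided in the Lean kernel: `opeEpsUpper_2d_L15_opeEUB` (`Control2DL15OpeEUB`) and `opeEpsLower_2d_L15_opeELB`
(`Control2DL15OpeELB`; the LOWER sense through the SHARP Δ-uniform double-series tail majorant of `Control2DOpeEpsTailSharp` and the integer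
leaves of `Control2DOpeEpsKernelSharp`, scalar truncation `N = 80` on the box). This file only composes them: **`pBoxTwoSided_2d_L15`** —
`2^{e₁}·P̃_lo < p_box < 2^{e₂}·P̃_hi` for the total in-box scalar coefficient of every admissible datum — and its decimal form
**`pBoxTwoSided_2d_L15_decimal`**: `0.123674 < p_box < 0.127625` (`λ²_σσ[box] = 2 p_box ∈ (0.247348, 0.25525)`; the 2D Ising values
`p_ε = 1/8`, `λ²_σσε = 1/4` inside). Zero grant compute. No facts, standard axioms only. [cite: RattazziEtAl2008, §5]
-/

namespace Summit.CriticalPhenomena.Ising3D.Control2D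

open Set
open Literature.MathematicalPhysics.QuantumFieldTheory.ConformalBootstrap3D

/-- **2D control, `λ²` two-sided, kernel-complete at Λ = 15**: `PBoxTwoSided (1/8) 2 1 (197/200) (20001/20000) (2^{197/200}·15621/250000)
(2^{20001/20000}·319051/5000000)` — `pBoxTwoSided_rb6_L15` with BOTH hypotheses discharged by kernel replays. CONTROL-ONLY (d = 2).
[cite: RattazziEtAl2008, §5] -/
theorem pBoxTwoSided_2d_L15 :
    PBoxTwoSided (1 / 8) 2 1 (197 / 200) (20001 / 20000)
      ((2 : ℝ) ^ (197 / 200 : ℝ) * (15621 / 250000)) ((2 : ℝ) ^ (20001 / 20000 : ℝ) * (319051 / 5000000)) :=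
  pBoxTwoSided_rb6_L15 opeEpsLower_2d_L15_opeELB opeEpsUpper_2d_L15_opeEUB

/-- **The decimal form, kernel-complete at Λ = 15**: `0.123674 < p_box < 0.127625` for every admissible datum, and `1/8` lies inside.
CONTROL-ONLY (d = 2). [cite: RattazziEtAl2008, §5] -/
theorem pBoxTwoSided_2d_L15_decimal :
    PBoxTwoSided (1 / 8) 2 1 (197 / 200) (20001 / 20000) (123674 / 1000000) (127625 / 1000000) ∧
      (123674 / 1000000 : ℝ) < 1 / 8 ∧ (1 / 8 : ℝ) < 127625 / 1000000 :=
  pBoxTwoSided_rb6_L15_decimal pBoxTwoSided_2d_L15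

end Summit.CriticalPhenomena.Ising3D.Control2D
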